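import Summits.Ventures.PercRepro.RankLevelSetHallRuleQ

/-!
# PercRepro — C-044, UP form: THE FLAT-WEIGHTED SPLIT (p4, gen 30; paper proofs/P4-CELL-THREE.md §14)

Rule Q (RankLevelSetHallRuleQ) splits the unit of every `S ∈ Y(p,q)` EQUALLY among the members `Z ⊆ S`; at the tight
layer `#E = p + q` it pays every member of the slices `q − #P ≤ 1` and `q − #P ≥ k − 2` (`k = p − q`) of every cell, and
FAILS on the truncated slices `2 ≤ q − #P ≤ k − 3` once `q` is large (the slice map of record, night-1 / p4): on the model
matroid `T_p(U_{q,q+m} ⊕ free)` the members `Z ⊆ F` receive exactly `R̂(q,k,m) < Φ`, while the other members (those using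
`t ≥ 1` free points, whose closure is themselves) receive several times `Φ`.

THE REPAIR: weight the members of `S` by how many further elements of `S` they span.  For a member `Z ⊆ S` let
`spanCount S Z = #((S ∖ Z) ∩ cl Z)` (`= #(S ∩ flatPart Z)` for `Z ⊆ S ⊆ E`).  For a weight function `g : ℕ → ℚ` the
FLAT-WEIGHTED SPLIT gives `Z` the share `g(spanCount S Z) / Σ_{Z' ⊆ S member} g(spanCount S Z')` of the unit of `S`.
`g ≡ 1` is Rule Q; **Rule D** is `g = dWeight` (`1` on `0`, `2` otherwise: a member spanning at least one further
element of `S` counts double); **Rule P** is `g n = n + 1`.  Numerically (paper §14) Rule D and Rule P pay every member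
at the tight layer on every block model tested, including the model family where Rule Q fails (e.g. `(q,k,#P) = (672,5,670)`:
Rule Q `0.99999·Φ`, Rule D `1.94·Φ`, Rule P `13.96·Φ` for `Z ⊆ F`; the free members keep `≥ 5.97·Φ`), and on every matroid
with `≤ 8` elements (0 failures).  NOT asserted here: `FlatWeightUp` (the rule pays every member) is a `Prop`.

THIS FILE: the definitions, the transfer **`hallUp_of_flatWeight`** — for EVERY positive weight `g`, if the flat-weighted
split pays `Φ(p,q)` to every member then the UP-Hall condition of C-044 holds for every subfamily (the double count of
RankLevelSetHallRuleQ with the loads `Σ_{Z ∈ 𝒜, Z ⊆ S} g/Σ g ≤ 1`) — its instances `hallUp_of_ruleD`, `hallUp_of_ruleP`,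
the identification `fwRecv_one_eq_ruleQRecv` (`g ≡ 1` is Rule Q), and the comparison `fwRecv_ge_ruleQRecv_div`: a weight
with `1 ≤ g ≤ c` pays every member at least `1/c` of its Rule-Q receipt (so Rule D pays at least half of Rule Q).
Axioms standard.
-/

namespace PercRepro

open Set Matroid Finset

variable {α : Type} (M : Matroid α) [M.Finite]

/-- `spanCount S Z`: the number of elements of `S` outside `Z` that lie in the closure of `Z`. -/
noncomputable def spanCount (S Z : Set α) : ℕ := ((S \ Z) ∩ M.closure Z).ncard

open Classical in
/-- The members of the cell `(p, q)` inside `S`, as a Finset. -/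
noncomputable def fwMembersIn (p q : ℕ) (S : Set α) : Finset (Set α) :=
  (cellMembers_finite M p q).toFinset.filter (fun Z => Z ⊆ S)

/-- The total weight of `S` under the flat-weighted split with weight `g`. -/
noncomputable def fwTotal (p q : ℕ) (g : ℕ → ℚ) (S : Set α) : ℚ :=
  ∑ Z ∈ fwMembersIn M p q S, g (spanCount M S Z)

/-- What the member `Z` receives under the flat-weighted split with weight `g`:
`Σ_{S ∈ Y, Z ⊆ S} g(spanCount S Z) / fwTotal S`. -/
noncomputable def fwRecv (p q : ℕ) (g : ℕ → ℚ) (Z : Set α) : ℚ :=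
  ∑ S ∈ (cellY_finite M p q).toFinset,
    Set.indicator {S : Set α | Z ⊆ S} (fun S => g (spanCount M S Z) / fwTotal M p q g S) S

/-- The flat-weighted split with weight `g` pays every member of the cell (a `Prop`; NOT asserted). -/
def FlatWeightUp (p q : ℕ) (g : ℕ → ℚ) : Prop :=
  ∀ Z ∈ cellMembers M p q, phiK p q ≤ fwRecv M p q g Z

/-- The weight of Rule D: `1` for a member spanning no further element of `S`, `2` otherwise. -/
def dWeight (n : ℕ) : ℚ := if n = 0 then 1 else 2

/-- The weight of Rule P: `n + 1`. -/
def pWeight (n : ℕ) : ℚ := n + 1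

/-- **Rule D** for the cell `(p, q)` of `M` (NOT asserted): every member receives at least `Φ(p,q)` when the members of
every `S ∈ Y` spanning a further element of `S` count double. -/
def RuleDUp (p q : ℕ) : Prop := FlatWeightUp M p q dWeight

/-- **Rule P** for the cell `(p, q)` of `M` (NOT asserted): every member receives at least `Φ(p,q)` when every member of
`S ∈ Y` is weighted by `1 +` the number of further elements of `S` it spans. -/
def RulePUp (p q : ℕ) : Prop := FlatWeightUp M p q pWeight

/-- The weight of Rule D is positive. -/
lemma dWeight_pos (n : ℕ) : 0 < dWeight n := by
  unfold dWeight; split_ifs <;> norm_num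

/-- The weight of Rule P is positive. -/
lemma pWeight_pos (n : ℕ) : 0 < pWeight n := by
  unfold pWeight; positivity

/-- `Z ∈ fwMembersIn S` iff `Z` is a member of the cell contained in `S`. -/
lemma mem_fwMembersIn {p q : ℕ} {S Z : Set α} :
    Z ∈ fwMembersIn M p q S ↔ Z ∈ cellMembers M p q ∧ Z ⊆ S := by
  classical
  unfold fwMembersIn
  rw [Finset.mem_filter, (cellMembers_finite M p q).mem_toFinset]

/-- The total weight of `S` is positive as soon as one member lies inside `S` (positive weights). -/
lemma fwTotal_pos {p q : ℕ} {g : ℕ → ℚ} (hg : ∀ n, 0 < g n) {S Z : Set α}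
    (hZ : Z ∈ cellMembers M p q) (hZS : Z ⊆ S) : 0 < fwTotal M p q g S := by
  unfold fwTotal
  refine Finset.sum_pos' (fun Z' _ => (hg _).le) ⟨Z, (mem_fwMembersIn M).2 ⟨hZ, hZS⟩, hg _⟩

/-- **The transfer**: if the flat-weighted split with a positive weight `g` pays `Φ(p,q)` to every member, then every
subfamily `𝒜` of members has at least `Φ(p,q)·#𝒜` UP-neighbours (the loads of the sets `S` are at most `1`). -/
theorem hallUp_of_flatWeight (p q : ℕ) (g : ℕ → ℚ) (hg : ∀ n, 0 < g n) (h : FlatWeightUp M p q g)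
    (𝒜 : Set (Set α)) (h𝒜 : 𝒜 ⊆ cellMembers M p q) :
    phiK p q * (𝒜.ncard : ℚ) ≤ ((upNbhd M p q 𝒜).ncard : ℚ) := by
  classical
  have h𝒜fin : 𝒜.Finite := (cellMembers_finite M p q).subset h𝒜
  set 𝒜f : Finset (Set α) := h𝒜fin.toFinset with h𝒜f
  set Yf : Finset (Set α) := (cellY_finite M p q).toFinset with hYf
  have h𝒜card : (𝒜.ncard : ℚ) = (𝒜f.card : ℚ) := by
    rw [h𝒜f, ncard_eq_toFinset_card _ h𝒜fin]
  -- step 1: Φ·#𝒜 ≤ Σ_{Z ∈ 𝒜} recv(Z)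
  have h1 : phiK p q * (𝒜f.card : ℚ) ≤ ∑ Z ∈ 𝒜f, fwRecv M p q g Z := by
    rw [mul_comm, ← nsmul_eq_mul, ← Finset.sum_const]
    refine Finset.sum_le_sum (fun Z hZ => ?_)
    rw [h𝒜f, h𝒜fin.mem_toFinset] at hZ
    exact h Z (h𝒜 hZ)
  -- step 2: exchange the sums
  have h2 : ∑ Z ∈ 𝒜f, fwRecv M p q g Z =
      ∑ S ∈ Yf, ∑ Z ∈ 𝒜f.filter (fun Z => Z ⊆ S), g (spanCount M S Z) / fwTotal M p q g S := by
    unfold fwRecv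
    rw [← hYf, Finset.sum_comm]
    refine Finset.sum_congr rfl (fun S _ => ?_)
    rw [Finset.sum_filter]
    refine Finset.sum_congr rfl (fun Z _ => ?_)
    simp only [Set.indicator_apply, Set.mem_setOf_eq]
  -- step 3: each load is at most the indicator of «S contains a member of 𝒜»
  have h3 : ∀ S ∈ Yf, ∑ Z ∈ 𝒜f.filter (fun Z => Z ⊆ S), g (spanCount M S Z) / fwTotal M p q g S ≤
      (if ∃ Z ∈ 𝒜, Z ⊆ S then (1 : ℚ) else 0) := by
    intro S _
    by_cases hex : ∃ Z ∈ 𝒜, Z ⊆ S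
    · rw [if_pos hex]
      obtain ⟨Z₀, hZ₀, hZ₀S⟩ := hex
      have hpos : 0 < fwTotal M p q g S := fwTotal_pos M hg (h𝒜 hZ₀) hZ₀S
      rw [← Finset.sum_div, div_le_one hpos]
      unfold fwTotal
      refine Finset.sum_le_sum_of_subset_of_nonneg ?_ (fun Z _ _ => (hg _).le)
      intro Z hZ
      rw [Finset.mem_filter, h𝒜f, h𝒜fin.mem_toFinset] at hZ
      exact (mem_fwMembersIn M).2 ⟨h𝒜 hZ.1, hZ.2⟩
    · rw [if_neg hex]
      have hzero : 𝒜f.filter (fun Z => Z ⊆ S) = ∅ := by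
        rw [Finset.filter_eq_empty_iff]
        intro Z hZ hZS
        rw [h𝒜f, h𝒜fin.mem_toFinset] at hZ
        exact hex ⟨Z, hZ, hZS⟩
      rw [hzero, Finset.sum_empty]
  -- step 4: the indicators sum to the size of the UP-neighbourhood
  have h4 : ∑ S ∈ Yf, (if ∃ Z ∈ 𝒜, Z ⊆ S then (1 : ℚ) else 0) = ((upNbhd M p q 𝒜).ncard : ℚ) := by
    rw [Finset.sum_ite, Finset.sum_const_zero, add_zero, Finset.sum_const, nsmul_eq_mul, mul_one]
    have hU : upNbhd M p q 𝒜 = ((Yf.filter (fun S => ∃ Z ∈ 𝒜, Z ⊆ S) : Finset (Set α)) : Set (Set α)) := by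
      ext S
      rw [Finset.coe_filter, hYf, Set.mem_setOf_eq, (cellY_finite M p q).mem_toFinset]
      constructor
      · intro hS
        exact ⟨⟨hS.1, hS.2.1, hS.2.2.1⟩, hS.2.2.2⟩
      · intro hS
        exact ⟨hS.1.1, hS.1.2.1, hS.1.2.2, hS.2⟩
    rw [hU, ncard_coe_finset]
  calc phiK p q * (𝒜.ncard : ℚ) = phiK p q * (𝒜f.card : ℚ) := by rw [h𝒜card]
    _ ≤ ∑ Z ∈ 𝒜f, fwRecv M p q g Z := h1
    _ = ∑ S ∈ Yf, ∑ Z ∈ 𝒜f.filter (fun Z => Z ⊆ S), g (spanCount M S Z) / fwTotal M p q g S := h2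
    _ ≤ ∑ S ∈ Yf, (if ∃ Z ∈ 𝒜, Z ⊆ S then (1 : ℚ) else 0) := Finset.sum_le_sum h3
    _ = ((upNbhd M p q 𝒜).ncard : ℚ) := h4

/-- **Rule D gives the UP-Hall condition**: if every member receives at least `Φ(p,q)` under Rule D, every subfamily of
members has at least `Φ(p,q)·#𝒜` UP-neighbours. -/
theorem hallUp_of_ruleD (p q : ℕ) (h : RuleDUp M p q) (𝒜 : Set (Set α)) (h𝒜 : 𝒜 ⊆ cellMembers M p q) :
    phiK p q * (𝒜.ncard : ℚ) ≤ ((upNbhd M p q 𝒜).ncard : ℚ) :=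
  hallUp_of_flatWeight M p q dWeight dWeight_pos h 𝒜 h𝒜

/-- **Rule P gives the UP-Hall condition**. -/
theorem hallUp_of_ruleP (p q : ℕ) (h : RulePUp M p q) (𝒜 : Set (Set α)) (h𝒜 : 𝒜 ⊆ cellMembers M p q) :
    phiK p q * (𝒜.ncard : ℚ) ≤ ((upNbhd M p q 𝒜).ncard : ℚ) :=
  hallUp_of_flatWeight M p q pWeight pWeight_pos h 𝒜 h𝒜

/-- The members inside `S` number `memCount S` (the Finset `fwMembersIn` has the cardinality of Rule Q's count). -/
lemma card_fwMembersIn (p q : ℕ) (S : Set α) : (fwMembersIn M p q S).card = memCount M p q S := by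
  classical
  unfold memCount
  rw [← ncard_coe_finset]
  congr 1
  ext Z
  rw [Finset.mem_coe, mem_fwMembersIn, Set.mem_setOf_eq]

/-- The total weight of `S` under the constant weight `1` is `memCount S`. -/
lemma fwTotal_one (p q : ℕ) (S : Set α) : fwTotal M p q (fun _ => 1) S = (memCount M p q S : ℚ) := by
  unfold fwTotal
  rw [Finset.sum_const, nsmul_eq_mul, mul_one, card_fwMembersIn]

/-- **`g ≡ 1` is Rule Q**: the flat-weighted split with the constant weight `1` is the equal split. -/
theorem fwRecv_one_eq_ruleQRecv (p q : ℕ) (Z : Set α) :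
    fwRecv M p q (fun _ => 1) Z = ruleQRecv M p q Z := by
  unfold fwRecv ruleQRecv
  refine Finset.sum_congr rfl (fun S _ => ?_)
  simp only [fwTotal_one]

/-- A weight with `1 ≤ g ≤ c` keeps the share of every member inside `S` at least `1/c` of its Rule-Q share. -/
lemma fwShare_ge_div {p q : ℕ} {g : ℕ → ℚ} {c : ℚ} (hg1 : ∀ n, 1 ≤ g n) (hgc : ∀ n, g n ≤ c)
    {S Z : Set α} (hZ : Z ∈ cellMembers M p q) (hZS : Z ⊆ S) :
    1 / (memCount M p q S : ℚ) / c ≤ g (spanCount M S Z) / fwTotal M p q g S := by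
  have hc : (1 : ℚ) ≤ c := (hg1 0).trans (hgc 0)
  have hcpos : (0 : ℚ) < c := by linarith
  have hpos : 0 < fwTotal M p q g S := fwTotal_pos M (fun n => lt_of_lt_of_le one_pos (hg1 n)) hZ hZS
  have hmem : 0 < memCount M p q S := by
    rw [← card_fwMembersIn]
    exact Finset.card_pos.2 ⟨Z, (mem_fwMembersIn M).2 ⟨hZ, hZS⟩⟩
  have hmemq : (0 : ℚ) < (memCount M p q S : ℚ) := by exact_mod_cast hmem
  have htot : fwTotal M p q g S ≤ c * (memCount M p q S : ℚ) := by
    unfold fwTotal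
    rw [← card_fwMembersIn, mul_comm, ← nsmul_eq_mul, ← Finset.sum_const]
    exact Finset.sum_le_sum (fun Z' _ => hgc _)
  rw [div_div, div_le_div_iff₀ (by positivity) hpos, one_mul]
  calc fwTotal M p q g S ≤ c * (memCount M p q S : ℚ) := htot
    _ = 1 * ((memCount M p q S : ℚ) * c) := by ring
    _ ≤ g (spanCount M S Z) * ((memCount M p q S : ℚ) * c) :=
        mul_le_mul_of_nonneg_right (hg1 _) (by positivity)

/-- **Comparison with Rule Q**: a weight with `1 ≤ g ≤ c` pays every member at least `1/c` of its Rule-Q receipt;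
in particular Rule D (`c = 2`) pays at least half of Rule Q. -/
theorem fwRecv_ge_ruleQRecv_div (p q : ℕ) (g : ℕ → ℚ) (c : ℚ) (hg1 : ∀ n, 1 ≤ g n) (hgc : ∀ n, g n ≤ c)
    (Z : Set α) (hZ : Z ∈ cellMembers M p q) :
    ruleQRecv M p q Z / c ≤ fwRecv M p q g Z := by
  classical
  unfold ruleQRecv fwRecv
  rw [Finset.sum_div]
  refine Finset.sum_le_sum (fun S _ => ?_)
  simp only [Set.indicator_apply, Set.mem_setOf_eq]
  split_ifs with hZS
  · exact fwShare_ge_div M hg1 hgc hZ hZS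
  · exact le_of_eq (zero_div c)

/-- The weight of Rule D is at least `1`. -/
lemma dWeight_ge_one (n : ℕ) : 1 ≤ dWeight n := by
  unfold dWeight; split_ifs <;> norm_num

/-- The weight of Rule D is at most `2`. -/
lemma dWeight_le_two (n : ℕ) : dWeight n ≤ 2 := by
  unfold dWeight; split_ifs <;> norm_num

/-- **Rule D pays at least half of Rule Q** to every member. -/
theorem ruleDRecv_ge_half (p q : ℕ) (Z : Set α) (hZ : Z ∈ cellMembers M p q) :
    ruleQRecv M p q Z / 2 ≤ fwRecv M p q dWeight Z :=
  fwRecv_ge_ruleQRecv_div M p q dWeight 2 dWeight_ge_one dWeight_le_two Z hZ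

end PercRepro
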